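import Summits.CriticalPhenomena.PercolationContinuityZ3.Theorems.PercNearOneGluingNoHeavyLowerTailSahiThreeCopyCellFace

/-!
# `NoHeavyLowerTail` (crux stmt-CriticalPhenomena-4575), Sahi programme: **CELL CERTIFICATES VI — the checker WITH SQUARE TERMS `checkCellSq`
# and its soundness**

Support file (Sahi cell, seat `prim-sahi-p1`, generation 65; `--supports stmt-CriticalPhenomena-4575`); part VI of the verified cell-certificate checker
(part V `…CellFace`: square terms `SqTerm`, `sqOK`, `sqExpand`, `ghEval_sqExpand`, `sum_sqTriples`, `sqFormAt_nonneg`).  No evaluation; no `sorry`,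
standard axioms.

CONTENT.  ★ `checkCellSq k π fZ ℓZ M P Q C S` = `checkCell` with the (GH) identity read as `diag(ρ) + D·B = Σ x·u ⊗ v + Σ_{t ∈ S} (square term t)`
and every square term admissible (`sqOK`); ★★ `cellFacts_of_checkCellSq`: acceptance ⇒ `CellFacts` for the cell `(P, Q)` with the weight `θ_{ρ/D}`
(rank-one terms nonnegative on the cell as in part III, square terms nonnegative at all nonnegative monotone pairs by `sqFormAt_nonneg`), hence
`PointwiseTP` / `LawGood` through `pointwiseTP_of_exists_cellFacts`, transport and transposition (part IV).  §4: unverified producers `CellRepsSq`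
(square representatives expand by EVERY `g ∈ Γ`, with multiplicity — the convention of the Γ-invariant LP `tplcell_face.py`), `actSq`, `sqTranspose`,
`CellRepsSq.expandSq`, `transportSq`. [this work]
-/

namespace Summit.CriticalPhenomena.PercolationContinuityZ3.Theorems.SahiThreeCopy

open Finset Function Literature.Combinatorics.Sahi2008
open scoped BigOperators

variable {k : ℕ}

/-! ### §3 The checker with square terms and its soundness -/

/-- The integer kernel of all square terms at codes of levels = the value of their real triples. [this work] -/
theorem ghEval_sqExpandAll : ∀ (S : List SqTerm), (∀ t ∈ S, sqOK k t = true) → ∀ e e' : Pt k,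
    (ghEval (sqExpandAll S) (codeOf k e) (codeOf k e') : ℝ) = ((sqTriplesAll k S).map fun tr => tr.2.2 * (tr.1 e * tr.2.1 e')).sum
  | [], _, e, e' => by simp [sqExpandAll, sqTriplesAll, ghEval]
  | t :: S, hS, e, e' => by
    have ht := hS t (by simp)
    unfold sqOK at ht
    simp only [Bool.and_eq_true] at ht
    rw [sqExpandAll, sqTriplesAll, ghEval_append, Int.cast_add, ghEval_sqExpand t ht.1.1 ht.1.2, List.map_append, List.sum_append,
      ghEval_sqExpandAll S (fun t' h' => hS t' (by simp [h'])) e e']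

/-- The real triples of all square terms against `(φ, ψ)` sum to the sum of their square forms. [this work] -/
theorem sum_sqTriplesAll (φ ψ : Pt k → ℝ) : ∀ (S : List SqTerm),
    ((sqTriplesAll k S).map fun tr => tr.2.2 * ((∑ e, tr.1 e * φ e) * ∑ e', tr.2.1 e' * ψ e')).sum = (S.map fun t => sqFormAt k t φ ψ).sum
  | [] => by simp [sqTriplesAll]
  | t :: S => by rw [sqTriplesAll, List.map_append, List.sum_append, sum_sqTriples, sum_sqTriplesAll φ ψ S, List.map_cons, List.sum_cons]

/-- The (GH)-array of a certificate WITH SQUARE TERMS. [this work] -/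
def CellCertificate.ghArrSq (k : ℕ) (ℓZ : ℕ → Pt k → ℤ) (C : CellCertificate) (S : List SqTerm) : Array (Array ℤ) :=
  accGH (Array.replicate (2 ^ k) (Array.replicate (2 ^ k) 0))
    ((C.prods.map fun t => (genSparse k ℓZ t.1, genSparse k ℓZ t.2.1, t.2.2)) ++ sqExpandAll S)

/-- ★ THE CHECKER WITH SQUARE TERMS: as `checkCell`, plus admissibility of every square term, with (GH) read as
`diag(ρ) + D·B = Σ x·u ⊗ v + Σ (square terms)`. [this work] -/
def checkCellSq (k : ℕ) (π : Fin k → ℕ) (fZ : Pt k → ℤ) (ℓZ : ℕ → Pt k → ℤ) (M P Q : ℕ) (C : CellCertificate) (S : List SqTerm) : Bool :=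
  let N := 2 ^ k
  let K := C.kArr k
  let A := C.ghArrSq k ℓZ S
  decide (0 < C.D)
  && C.rho.all (fun pa => decide (0 ≤ pa.2))
  && C.sig.all (fun pa => decide (0 ≤ pa.2))
  && C.lam.all (fun t => decide (t.1 < N) && decide (t.2.1 < N) && (t.1 ||| t.2.1 == t.2.1) && decide (0 ≤ t.2.2))
  && C.prods.all (fun t => genOK k M P t.1 && genOK k M Q t.2.1 && decide (0 ≤ t.2.2))
  && S.all (sqOK k)
  && (List.range N).all (fun n => decide (evalSparse C.rho n = 0) || decide (nArr1Z π (ptOfCode k n) ≠ 0))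
  && (List.range N).all (fun n => decide (K[n]? = some ((C.D : ℤ) * cKZ π fZ (ptOfCode k n))))
  && (List.range N).all (fun i => (List.range N).all fun j =>
        decide (entry2 A i j = some ((if i = j then evalSparse C.rho i else 0) + (C.D : ℤ) * BZ π fZ (ptOfCode k i) (ptOfCode k j))))

/-- Unpacking `checkCellSq = true`. [this work] -/
theorem checkCellSq_spec {π : Fin k → ℕ} {fZ : Pt k → ℤ} {ℓZ : ℕ → Pt k → ℤ} {M P Q : ℕ} {C : CellCertificate} {S : List SqTerm}
    (h : checkCellSq k π fZ ℓZ M P Q C S = true) :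
    0 < C.D ∧ (∀ pa ∈ C.rho, 0 ≤ pa.2) ∧ (∀ pa ∈ C.sig, 0 ≤ pa.2)
    ∧ (∀ t ∈ C.lam, t.1 < 2 ^ k ∧ t.2.1 < 2 ^ k ∧ t.1 ||| t.2.1 = t.2.1 ∧ 0 ≤ t.2.2)
    ∧ (∀ t ∈ C.prods, genOK k M P t.1 = true ∧ genOK k M Q t.2.1 = true ∧ 0 ≤ t.2.2)
    ∧ (∀ t ∈ S, sqOK k t = true)
    ∧ (∀ n, n < 2 ^ k → evalSparse C.rho n = 0 ∨ nArr1Z π (ptOfCode k n) ≠ 0)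
    ∧ (∀ n, n < 2 ^ k → (C.kArr k)[n]? = some ((C.D : ℤ) * cKZ π fZ (ptOfCode k n)))
    ∧ (∀ i j, i < 2 ^ k → j < 2 ^ k → entry2 (C.ghArrSq k ℓZ S) i j =
        some ((if i = j then evalSparse C.rho i else 0) + (C.D : ℤ) * BZ π fZ (ptOfCode k i) (ptOfCode k j))) := by
  unfold checkCellSq at h
  simp only [Bool.and_eq_true, List.all_eq_true, decide_eq_true_eq, Bool.or_eq_true, beq_iff_eq, List.mem_range] at h
  obtain ⟨⟨⟨⟨⟨⟨⟨⟨hD, hrho⟩, hsig⟩, hlam⟩, hprods⟩, hS⟩, hn⟩, hK⟩, hGH⟩ := h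
  exact ⟨hD, hrho, hsig, fun t ht => by simpa [and_assoc] using hlam t ht, fun t ht => by simpa [and_assoc] using hprods t ht, hS, hn,
    hK, fun i j hi hj => hGH i hi j hj⟩

/-- The (GH)-array with squares at in-range codes of levels: products part + squares part. [this work] -/
theorem ghArrSq_get (ℓZ : ℕ → Pt k → ℤ) {M P Q : ℕ} (C : CellCertificate) (S : List SqTerm)
    (hp : ∀ t ∈ C.prods, genOK k M P t.1 = true ∧ genOK k M Q t.2.1 = true ∧ 0 ≤ t.2.2) (e e' : Pt k) :
    entry2 (C.ghArrSq k ℓZ S) (codeOf k e) (codeOf k e') =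
      some ((C.prods.map fun t => t.2.2 * (genFunZ k ℓZ t.1 e * genFunZ k ℓZ t.2.1 e')).sum + ghEval (sqExpandAll S) (codeOf k e) (codeOf k e')) := by
  unfold CellCertificate.ghArrSq
  rw [entry2_accGH, entry2_replicate (codeOf_lt k e) (codeOf_lt k e'), ghEval_append, ghEval_map_genSparse ℓZ C.prods hp]
  simp

/-- ★★ **SOUNDNESS OF THE CHECKER WITH SQUARE TERMS.**  Acceptance delivers `CellFacts` for the cell `(P, Q)` (weight `θ_{ρ/D}`): the rank-one
terms are nonnegative on the cell as before,
    and every square term is nonnegative on all nonnegative monotone pairs (`sqFormAt_nonneg`). [this work] -/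
theorem cellFacts_of_checkCellSq {π : Fin k → ℕ} {fZ : Pt k → ℤ} {ℓZ : ℕ → Pt k → ℤ} {M P Q : ℕ} {C : CellCertificate} {S : List SqTerm}
    (h : checkCellSq k π fZ ℓZ M P Q C S = true) :
    CellFacts k π (fun x => (fZ x : ℝ)) M (fun j e => (ℓZ j e : ℝ)) P Q (thetaOf π (C.rhoR k)) := by
  obtain ⟨hD, hrho, hsig, hlam, hprods, hS, hn, hK, hGH⟩ := checkCellSq_spec h
  have hDpos : (0 : ℝ) < (C.D : ℝ) := by exact_mod_cast hD
  have hρ0 : ∀ e, 0 ≤ C.rhoR k e := fun e =>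
    div_nonneg (by exact_mod_cast evalSparse_nonneg C.rho hrho _) hDpos.le
  have hn' : ∀ e, nArr1 π e ≠ 0 ∨ C.rhoR k e = 0 := by
    intro e
    rcases hn (codeOf k e) (codeOf_lt k e) with h0 | h0
    · right; simp [CellCertificate.rhoR, h0]
    · left; rw [nArr1_eq_nArr1Z, ptOfCode_codeOf] at *; exact_mod_cast h0
  have hKe : ∀ e : Pt k, (C.D : ℝ) * cKcoef π (fun x => (fZ x : ℝ)) e =
      (evalSparse C.rho (codeOf k e) : ℝ) + (evalSparse C.sig (codeOf k e) : ℝ) + (lamEval C.lam (codeOf k e) : ℝ) := by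
    intro e
    have h1 := hK (codeOf k e) (codeOf_lt k e)
    rw [kArr_get C (codeOf_lt k e), ptOfCode_codeOf] at h1
    have h2 := Option.some.inj h1
    rw [cKcoef_eq_cKZ]; exact_mod_cast h2.symm
  -- the combined real rank-one list: admissible products, then the square triples
  set L : List ((Pt k → ℝ) × (Pt k → ℝ) × ℝ) :=
    (C.prods.map fun t => (fun x => (genFunZ k ℓZ t.1 x : ℝ), fun x => (genFunZ k ℓZ t.2.1 x : ℝ), (t.2.2 : ℝ))) ++ sqTriplesAll k S with hL
  have hGHe : ∀ e e' : Pt k, (if e = e' then (evalSparse C.rho (codeOf k e) : ℝ) else 0) + (C.D : ℝ) * Bcoef π (fun x => (fZ x : ℝ)) e e' =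
      (L.map fun t => t.2.2 * (t.1 e * t.2.1 e')).sum := by
    intro e e'
    have h1 := hGH (codeOf k e) (codeOf k e') (codeOf_lt k e) (codeOf_lt k e')
    rw [ghArrSq_get ℓZ C S hprods, ptOfCode_codeOf, ptOfCode_codeOf] at h1
    have h2 := Option.some.inj h1
    have hij : (codeOf k e = codeOf k e') ↔ (e = e') :=
      ⟨fun hh => by rw [← ptOfCode_codeOf k e, hh, ptOfCode_codeOf], fun hh => by rw [hh]⟩
    rw [if_congr hij rfl rfl] at h2
    rw [Bcoef_eq_BZ, hL, List.map_append, List.sum_append, List.map_map, ← ghEval_sqExpandAll S hS e e']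
    have h3 : ((if e = e' then (evalSparse C.rho (codeOf k e) : ℝ) else 0) + (C.D : ℝ) * (BZ π fZ e e' : ℝ)) =
        (((if e = e' then evalSparse C.rho (codeOf k e) else 0) + (C.D : ℤ) * BZ π fZ e e' : ℤ) : ℝ) := by push_cast; split_ifs <;> simp
    rw [h3, ← h2, Int.cast_add, intCast_sum_map]
    congr 1
    refine congrArg _ (List.map_congr_left fun t _ => ?_)
    simp only [Function.comp]
    push_cast; ring
  refine ⟨fun e₁ e₂ e₃ => thetaOf_nonneg π hρ0 e₁ e₂ e₃, ?_, ?_⟩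
  · -- (N1): identical to the square-free case
    intro κ hκ0 hκm
    rw [N1form_split, N1form_zero_eq, thetaLin_thetaOf π _ _ hn']
    simp only [Pi.mul_apply, Pi.one_apply, mul_one]
    rw [← sum_sub_distrib]
    have hDne : (C.D : ℝ) ≠ 0 := hDpos.ne'
    have key : ∀ e, cKcoef π (fun x => (fZ x : ℝ)) e * κ e - C.rhoR k e * κ e =
        (1 / (C.D : ℝ)) * (((evalSparse C.sig (codeOf k e) : ℝ)) * κ e + (lamEval C.lam (codeOf k e) : ℝ) * κ e) := by
      intro e
      have hc : cKcoef π (fun x => (fZ x : ℝ)) e =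
          ((evalSparse C.rho (codeOf k e) : ℝ) + (evalSparse C.sig (codeOf k e) : ℝ) + (lamEval C.lam (codeOf k e) : ℝ)) / (C.D : ℝ) := by
        rw [eq_div_iff hDne, mul_comm]; exact hKe e
      simp only [CellCertificate.rhoR, hc]
      field_simp
      ring
    simp only [key, ← mul_sum, sum_add_distrib]
    refine mul_nonneg (by positivity) (add_nonneg (sum_nonneg fun e _ => mul_nonneg ?_ (hκ0 e)) ?_)
    · exact_mod_cast evalSparse_nonneg C.sig hsig _
    · rw [sum_lamEval_mul κ C.lam hlam]
      refine List.sum_nonneg ?_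
      intro x hx
      rw [List.mem_map] at hx
      obtain ⟨t, ht, rfl⟩ := hx
      have htt := hlam t ht
      exact mul_nonneg (by exact_mod_cast htt.2.2.2) (sub_nonneg.2 (hκm (ptOfCode_le_of_lor htt.2.2.1)))
  · -- (N2) on the cell
    intro φ ψ hφ hψ hφm hψm hφc hψc
    rw [N2form_split, N2form_zero_eq, thetaLin_thetaOf π _ _ hn']
    simp only [Pi.mul_apply]
    have hdiag : ∑ e : Pt k, C.rhoR k e * (φ e * ψ e) =
        ∑ e : Pt k, ∑ e' : Pt k, (if e = e' then C.rhoR k e else 0) * (φ e * ψ e') := by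
      refine sum_congr rfl fun e _ => ?_
      rw [Finset.sum_eq_single e]
      · simp
      · intro e' _ he; simp [Ne.symm he]
      · intro hh; exact absurd (mem_univ _) hh
    rw [hdiag, ← sum_add_distrib]
    have key : ∀ e, (∑ e', Bcoef π (fun x => (fZ x : ℝ)) e e' * (φ e * ψ e')) + ∑ e', (if e = e' then C.rhoR k e else 0) * (φ e * ψ e') =
        (1 / (C.D : ℝ)) * ∑ e', (L.map fun t => t.2.2 * (t.1 e * t.2.1 e')).sum * (φ e * ψ e') := by
      intro e
      rw [← sum_add_distrib, mul_sum]
      refine sum_congr rfl fun e' _ => ?_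
      rw [← hGHe e e']
      have hDne : (C.D : ℝ) ≠ 0 := hDpos.ne'
      simp only [CellCertificate.rhoR]
      by_cases hee : e = e'
      · subst hee; simp only [if_true]; field_simp; ring
      · simp only [hee, if_false]; field_simp; ring
    simp only [key, ← mul_sum]
    refine mul_nonneg (by positivity) ?_
    rw [sum_rankOne_eq, hL, List.map_append, List.sum_append]
    refine add_nonneg (rankOne_nonneg _ ?_ ?_ ?_) ?_
    · intro t ht
      rw [List.mem_map] at ht
      obtain ⟨s, hs, rfl⟩ := ht
      change (0 : ℝ) ≤ (s.2.2 : ℝ)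
      exact_mod_cast (hprods s hs).2.2
    · intro t ht
      rw [List.mem_map] at ht
      obtain ⟨s, hs, rfl⟩ := ht
      exact genFun_dot_nonneg ℓZ (hprods s hs).1 hφ hφm hφc
    · intro t ht
      rw [List.mem_map] at ht
      obtain ⟨s, hs, rfl⟩ := ht
      exact genFun_dot_nonneg ℓZ (hprods s hs).2.1 hψ hψm hψc
    · rw [sum_sqTriplesAll φ ψ S]
      refine List.sum_nonneg ?_
      intro x hx
      rw [List.mem_map] at hx
      obtain ⟨t, ht, rfl⟩ := hx
      exact sqFormAt_nonneg (hS t ht) hφ hψ hφm hψm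

/-! ### §4 Producers for square terms (unverified; only the output is checked) -/

/-- Orbit representatives WITH SQUARE TERMS: the square representatives expand by applying EVERY element of `Γ` (no deduplication). [this work] -/
structure CellRepsSq where
  /-- the rank-one part -/ base : CellReps
  /-- square-term representatives `(P, Q, M)` -/ squares : List SqTerm

/-- Image of a square term under `(τ, β)` (points by `τ`). [this work] -/
def actSq (g : List ℕ × List ℕ) (t : SqTerm) : SqTerm := (t.1.map (actPt g.1), t.2.1.map (actPt g.1), t.2.2)

/-- The transposed matrix of a square term (row-major `4 × 4`). [this work] -/
def sqTranspose (M : List ℤ) : List ℤ := (List.range 16).map fun i => M.getD (4 * (i % 4) + i / 4) 0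

/-- EXPANSION of the square representatives: every `Γ`-image of every representative (with multiplicity). [this work] -/
def CellRepsSq.expandSq (R : CellRepsSq) : List SqTerm := R.squares.flatMap fun t => R.base.gamma.map fun g => actSq g t

/-- TRANSPORT of square terms by an outer symmetry, optionally transposed (`(P,Q,M) ↦ (Q,P,Mᵀ)`). [this work] -/
def transportSq (g : List ℕ × List ℕ) (transpose : Bool) (S : List SqTerm) : List SqTerm :=
  S.map fun t => let t' := actSq g t; if transpose then (t'.2.1, t'.1, sqTranspose t'.2.2) else t'

end Summit.CriticalPhenomena.PercolationContinuityZ3.Theorems.SahiThreeCopy
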